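import Literature.NumberTheory.Sieve.HeathBrownCubicFLSequencesA
import Literature.NumberTheory.Sieve.HeathBrownCubicNormWindowSieve
import Literature.NumberTheory.LFunctions.MertensFormula
import Mathlib.NumberTheory.EulerProduct.Basic
import Mathlib.NumberTheory.ZetaValues
import HarnessLib

/-!
# Heath-Brown's Lemma 3.5, V: the products `∏_{p<z}(1 − ρ₀(p)/p)`, `∏_{p<z}∏_{P∣p}(1 − N(P)^{-1})` ((6.7)–(6.10))

Fifth file of the proof of the named fact `HeathBrown2001_lemma_3_5`
(`HeathBrownCubicSieveDecomposition`; D. R. Heath-Brown, *Primes represented by `x³ + 2y³`*, Acta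
Math. 186 (2001), Lemma 3.5, §6). The Fundamental Lemma produces for `𝒜_q` the product
`V_𝒜(z) = ∏_{p<z}(1 − ρ₀(p)/p)` and for the window sequences of `ℬ` the product
`V_ℬ(z) = ∏_{p<z}∏_{P∣p}(1 − N(P)^{-1})` (`z = X^τ`); (6.7)–(6.10) compare both with Mertens' product
`V(z) = ∏_{p<z}(1 − 1/p)`. This file PROVES (6.7) with the rate `O(1/log z)`:
`(6/π²)V_𝒜(z) = σ₀V(z)(1 + O(1/log z))`, where `σ₀ = lim ∏_{p<N}(1 − (ν_p−1)/p)` is the HYPOTHESIS of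
the named fact (and `σ₀ > 0` follows), from the factorisation
`1 − ρ₀(p)/p = (1 − (ν_p−1)/p)(1 − 1/p)(1 − p^{-2})^{-1}`, the Euler product `∏(1 − p^{-2}) = 6/π²`, and
the convergence rate of the singular product (two Mertens theorems with rate: the tree's
`sum_primesLE_idealNormCount_div_eq` for `∑ c_K(p)/p` and `Mertens.abs_primeRecipSum_sub_le` for `∑ 1/p`);
and it derives (6.9), `γ₀V_ℬ(z) = V(z)(1 + O(1/log z))`, from Mertens' theorem for the prime ideals of
`K` with the residue constant `γ₀` (Rosen 1999, Thm 2, grouped by rational primes), taken here as an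
explicit HYPOTHESIS of `exists_abs_prodB_sub_le_of` (to be proved separately; no named fact is
introduced). Mertens' product theorem itself is imported from the tree
(`Mertens.abs_prod_one_sub_inv_mul_log_sub_one_le`) and re-indexed from `p ≤ x` to `p < z`.

## Content (namespace `Literature.NumberTheory.Sieve.CubicSieve`), all proved

* `mertensProd`, `prodA`, `prodB`, `invSqProd`, `invSqProdNat`; `densityProduct_seqA`,
  `densityProduct_windowSeq` (the FL density products ARE `V_𝒜(z)`, `V_ℬ(z)`); positivity and `≤ 1`.
* **`abs_mertensProd_mul_sub_one_le`** (`|V(z)e^γ log z − 1| ≤ 60/log z`, `z ≥ e^{14}`), **`mertensProd_le`**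
  (`V(z) ≤ 14/log z`, `z ≥ 2`).
* `tendsto_invSqProdNat` (`∏_{p<n}(1 − p^{-2}) → 6/π²`, Mathlib's Euler product and `ζ(2) = π²/6`),
  **`invSqProd_bounds`** (`6/π² ≤ ∏_{p<z}(1−p^{-2}) ≤ (6/π²)/(1 − 2/(z−1))`).
* **`exists_abs_log_singularProductPartial_div_le`** (`|log S(M)/S(N)| ≤ C_S/log N`, `4 ≤ N ≤ M`),
  **`exists_abs_singularProductPartial_sub_le`** (`σ₀ > 0`, `|S(N) − σ₀| ≤ 2C_Sσ₀/log N`).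
* `one_sub_densA_eq`, `prodA_eq` (`V_𝒜 = S(⌈z⌉)·V·(∏(1−p^{-2}))^{-1}`), **`exists_abs_prodA_sub_le`** ((6.7)),
  `exists_prodA_le`, **`exists_abs_prodB_sub_le_of`** ((6.9) from the Mertens-`K` hypothesis).

## References

* D. R. Heath-Brown, *Primes represented by `x³ + 2y³`*, Acta Math. 186 (2001), 1–84: §6 (6.7)–(6.10),
  pp. 37–38. [cite: HeathBrownActa2001, §6 (6.7)–(6.10)]
* M. Rosen, *A generalization of Mertens' theorem*, J. Ramanujan Math. Soc. 14 (1999), 1–19, Thm 2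
  (the source of (6.9); hypothesis here). [cite: Rosen1999Mertens, Thm 2]

## Mathlib / tree search

Mathlib: `EulerProduct.eulerProduct_completely_multiplicative`, `hasSum_zeta_two`, `Filter.Tendsto.inv₀`,
`Real.abs_log_sub_add_sum_range_le`, `Real.abs_exp_sub_one_sub_id_le`, `le_of_tendsto`, `ge_of_tendsto`,
`Finset.prod_sdiff`, `Finset.sum_sdiff_eq_sub`. Tree: `LFunctions.MertensFormula`
(`abs_prod_one_sub_inv_mul_log_sub_one_le`, `abs_primeRecipSum_sub_le`), `LFunctions.DegreeOnePrimesPNT`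
(`sum_primesLE_idealNormCount_div_eq`), `HeathBrownCubicSieveDecomposition` (`singularProductPartial`,
`singularProductPartial_pos`, `cubeRootTwoCount_le_three`), `HeathBrownCubicFLSequencesA` (`densA_prime`,
`hasSieveDimension_densA`), `HeathBrownCubicNormWindowSieve` (`normDensityAt`, `windowSeq_densityProduct`,
`one_sub_normDensityAt_bounds`), `HeathBrownCubicUpperBoundTools` (`sum_inv_sq_tail_le`).
-/

noncomputable section

open Polynomial NumberField Finset Filter Topology

namespace Literature.NumberTheory.Sieve.CubicSieve

open LFunctions.CubeRootTwoField CubicPrimes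
open Literature.NumberTheory.LFunctions (idealNormCount)

/-! ### The three products over the rational primes `p < z` -/

/-- `V(z) = ∏_{p<z} (1 − 1/p)` (Mertens' product; `p < z` as in the tree's `primesProdBelow z`). [folklore] -/
def mertensProd (z : ℝ) : ℝ := ∏ p ∈ Nat.primesBelow ⌈z⌉₊, (1 - (p : ℝ)⁻¹)

/-- `V_𝒜(z) = ∏_{p<z} (1 − ρ₀(p)/p)`, the main-term product of the Fundamental Lemma for `𝒜_q`
("`∏_{p<X^τ}(1 − ρ₀(p)/p)`" in (6.3)). [cite: HeathBrownActa2001, §6 (6.3)] -/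
def prodA (z : ℝ) : ℝ := ∏ p ∈ Nat.primesBelow ⌈z⌉₊, (1 - densA p)

/-- `V_ℬ(z) = ∏_{p<z} (1 − ρ₁(p)/p) = ∏_{p<z}∏_{P∣p}(1 − N(P)^{-1})`, the main-term product for `ℬ`
("`∏_{p<X^τ}(1 − ρ₁(p)/p)`" in (6.6); the inner product is `1 − normDensityAt p` of
`HeathBrownCubicNormWindowSieve`). [cite: HeathBrownActa2001, §6 (6.6)] -/
def prodB (z : ℝ) : ℝ := ∏ p ∈ Nat.primesBelow ⌈z⌉₊, (1 - normDensityAt p)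

/-- `∏_{p<z} (1 − p^{-2})`, the partial Euler product of `ζ(2)^{-1} = 6/π²` entering (6.7). [folklore] -/
def invSqProd (z : ℝ) : ℝ := ∏ p ∈ Nat.primesBelow ⌈z⌉₊, (1 - ((p : ℝ) ^ 2)⁻¹)

/-- The density product of `𝒜_q` at `P(z)` is `V_𝒜(z)` (for every `q`). [folklore] -/
theorem densityProduct_seqA (X η : ℝ) (q : ℕ) (z : ℝ) :
    (seqA X η q).densityProduct (primesProdBelow z) = prodA z := by
  rw [SieveSequence.densityProduct, primeFactors_primesProdBelow]
  rfl

/-- The density product of the window sequence at `P(z)` is `V_ℬ(z)`. [folklore] -/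
theorem densityProduct_windowSeq (Y η z : ℝ) :
    (windowSeq Y η).densityProduct (primesProdBelow z) = prodB z :=
  windowSeq_densityProduct Y η z

/-- `0 < V(z) ≤ 1`. [folklore] -/
theorem mertensProd_pos_le (z : ℝ) : 0 < mertensProd z ∧ mertensProd z ≤ 1 := by
  have hf : ∀ p ∈ Nat.primesBelow ⌈z⌉₊, 0 < 1 - (p : ℝ)⁻¹ ∧ 1 - (p : ℝ)⁻¹ ≤ 1 := by
    intro p hp
    have hp2 : (2 : ℝ) ≤ p := by exact_mod_cast (Nat.prime_of_mem_primesBelow hp).two_le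
    have : (p : ℝ)⁻¹ ≤ 1 / 2 := by rw [inv_eq_one_div]; exact one_div_le_one_div_of_le two_pos hp2
    have : (0 : ℝ) ≤ (p : ℝ)⁻¹ := by positivity
    constructor <;> linarith
  exact ⟨prod_pos fun p hp => (hf p hp).1, prod_le_one (fun p hp => (hf p hp).1.le) fun p hp => (hf p hp).2⟩

/-- `0 < V_𝒜(z) ≤ 1` (`ρ₀(p)/p ≤ 1/2`). [folklore] -/
theorem prodA_pos_le (z : ℝ) : 0 < prodA z ∧ prodA z ≤ 1 := by
  have hf : ∀ p ∈ Nat.primesBelow ⌈z⌉₊, 0 < 1 - densA p ∧ 1 - densA p ≤ 1 := by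
    intro p hp
    obtain ⟨h0, h1⟩ := hasSieveDimension_densA.1 p (Nat.prime_of_mem_primesBelow hp)
    constructor <;> linarith
  exact ⟨prod_pos fun p hp => (hf p hp).1, prod_le_one (fun p hp => (hf p hp).1.le) fun p hp => (hf p hp).2⟩

/-- `0 < V_ℬ(z) ≤ 1`. [folklore] -/
theorem prodB_pos_le (z : ℝ) : 0 < prodB z ∧ prodB z ≤ 1 := by
  have hf : ∀ p ∈ Nat.primesBelow ⌈z⌉₊, 0 < 1 - normDensityAt p ∧ 1 - normDensityAt p ≤ 1 := fun p hp =>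
    ⟨(one_sub_normDensityAt_bounds (Nat.prime_of_mem_primesBelow hp)).2.1,
      (one_sub_normDensityAt_bounds (Nat.prime_of_mem_primesBelow hp)).2.2⟩
  exact ⟨prod_pos fun p hp => (hf p hp).1, prod_le_one (fun p hp => (hf p hp).1.le) fun p hp => (hf p hp).2⟩

/-! ### Mertens' theorem `V(z) e^γ log z = 1 + O(1/log z)` in the indexing `p < z` -/

/-- `primesBelow ⌈z⌉₊ = primesLE ⌊⌈z⌉₊ − 1⌋₊` (`z > 0`): the tree's Mertens theorems are indexed by
`p ≤ x`. [folklore] -/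
theorem primesBelow_ceil_eq (z : ℝ) :
    Nat.primesBelow ⌈z⌉₊ = Nat.primesLE ⌊(((⌈z⌉₊ - 1 : ℕ)) : ℝ)⌋₊ := by
  rw [Nat.floor_natCast]
  rcases Nat.eq_zero_or_pos ⌈z⌉₊ with h | h
  · rw [h]; decide
  · rw [Nat.primesLE, Nat.sub_add_cancel h]

/-- **Mertens' product theorem for `p < z`**: there is `C` with `|V(z) e^γ log z − 1| ≤ C/log z` for
`z ≥ e^{14}` (from the tree's `Literature.NumberTheory.LFunctions.Mertens.abs_prod_one_sub_inv_mul_log_sub_one_le`,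
indexed by `p ≤ x`, at `x = ⌈z⌉ − 1 ∈ [z − 1, z)`). [folklore] -/
theorem abs_mertensProd_mul_sub_one_le {z : ℝ} (hz : Real.exp 14 ≤ z) :
    |mertensProd z * (Real.exp Real.eulerMascheroniConstant * Real.log z) - 1| ≤ 60 / Real.log z := by
  set G := Real.exp Real.eulerMascheroniConstant with hG
  have hG0 : 0 < G := Real.exp_pos _
  have hz14 : (15 : ℝ) ≤ z := le_trans (by linarith [Real.add_one_le_exp (14 : ℝ)]) hz
  have hz0 : 0 < z := by linarith
  set x : ℝ := ((⌈z⌉₊ - 1 : ℕ) : ℝ) with hx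
  have hceil1 : 1 ≤ ⌈z⌉₊ := Nat.one_le_iff_ne_zero.mpr (Nat.pos_iff_ne_zero.mp (Nat.ceil_pos.mpr hz0))
  have hxz : z - 1 ≤ x ∧ x < z := by
    rw [hx, Nat.cast_sub hceil1, Nat.cast_one]
    exact ⟨by linarith [Nat.le_ceil z], by linarith [Nat.ceil_lt_add_one hz0.le]⟩
  have hx2 : 2 ≤ x := by linarith
  have hxhalf : z / 2 ≤ x := by linarith
  have hlogz : 0 < Real.log z := Real.log_pos (by linarith)
  have hlogx14 : 13 ≤ Real.log x := by
    have h1 : Real.log z - Real.log 2 ≤ Real.log x := by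
      rw [← Real.log_div hz0.ne' two_ne_zero]
      exact Real.log_le_log (by linarith) hxhalf
    have h2 : 14 ≤ Real.log z := by
      rw [← Real.log_exp 14]; exact Real.log_le_log (Real.exp_pos _) hz
    linarith [Real.log_two_lt_d9]
  have hlogx : 0 < Real.log x := by linarith
  have hlogxz : Real.log x ≤ Real.log z := Real.log_le_log (by linarith) hxz.2.le
  have hlogzx : Real.log z - Real.log x ≤ 2 / z := by
    rw [← Real.log_div hz0.ne' (by linarith)]
    have h := Real.log_le_sub_one_of_pos (show 0 < z / x from div_pos hz0 (by linarith))
    have : z / x - 1 ≤ 2 / z := by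
      rw [div_sub_one (by linarith), div_le_div_iff₀ (by linarith) hz0]
      nlinarith
    linarith
  have hV : mertensProd z = ∏ p ∈ Nat.primesLE ⌊x⌋₊, (1 - (p : ℝ)⁻¹) := by
    rw [mertensProd, primesBelow_ceil_eq]
  have hmain := Literature.NumberTheory.LFunctions.Mertens.abs_prod_one_sub_inv_mul_log_sub_one_le hx2 (by linarith)
  rw [← hV] at hmain
  obtain ⟨hV0, hV1⟩ := mertensProd_pos_le z
  -- `V G log x ≤ 3`
  have hVle : mertensProd z * (G * Real.log x) ≤ 3 := by
    have := (abs_le.mp hmain).2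
    have : 24 / Real.log x ≤ 2 := by rw [div_le_iff₀ hlogx]; linarith
    linarith
  have hzx1 : Real.log z - Real.log x ≤ 1 := hlogzx.trans (by rw [div_le_one hz0]; linarith)
  calc |mertensProd z * (G * Real.log z) - 1|
      = |(mertensProd z * (G * Real.log x) - 1) + mertensProd z * G * (Real.log z - Real.log x)| := by ring_nf
    _ ≤ |mertensProd z * (G * Real.log x) - 1| + |mertensProd z * G * (Real.log z - Real.log x)| := abs_add_le _ _
    _ ≤ 24 / Real.log x + mertensProd z * G * (2 / z) := by
        refine add_le_add hmain ?_
        rw [abs_of_nonneg (by nlinarith [mul_pos hV0 hG0])]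
        exact mul_le_mul_of_nonneg_left hlogzx (by positivity)
    _ ≤ 24 / Real.log x + 6 / (z * Real.log x) := by
        have heq : mertensProd z * G * (2 / z) = (mertensProd z * (G * Real.log x)) * (2 / (z * Real.log x)) := by
          field_simp
        rw [heq]
        have h2 : 0 ≤ 2 / (z * Real.log x) := by positivity
        have := mul_le_mul_of_nonneg_right hVle h2
        linarith [show (3 : ℝ) * (2 / (z * Real.log x)) = 6 / (z * Real.log x) by ring]
    _ ≤ 30 / Real.log x := by
        have : 6 / (z * Real.log x) ≤ 6 / Real.log x :=
          div_le_div_of_nonneg_left (by norm_num) hlogx (by nlinarith)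
        rw [show (30 : ℝ) / Real.log x = 24 / Real.log x + 6 / Real.log x by ring]
        linarith
    _ ≤ 60 / Real.log z := by
        rw [div_le_div_iff₀ hlogx hlogz]
        nlinarith

/-- **`V(z) ≤ C_V/log z`** for all `z ≥ 2` (Mertens; with `C_V = 14`). [folklore] -/
theorem mertensProd_le {z : ℝ} (hz : 2 ≤ z) : mertensProd z ≤ 14 / Real.log z := by
  have hlogz : 0 < Real.log z := Real.log_pos (by linarith)
  obtain ⟨hV0, hV1⟩ := mertensProd_pos_le z
  by_cases h : Real.exp 14 ≤ z
  · have hm := (abs_le.mp (abs_mertensProd_mul_sub_one_le h)).2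
    have hlog14 : 14 ≤ Real.log z := by
      rw [← Real.log_exp 14]; exact Real.log_le_log (Real.exp_pos _) h
    have hG1 : 1 ≤ Real.exp Real.eulerMascheroniConstant := Real.one_le_exp (by
      linarith [Real.one_half_lt_eulerMascheroniConstant])
    have h60 : 60 / Real.log z ≤ 5 := by rw [div_le_iff₀ hlogz]; linarith
    rw [le_div_iff₀ hlogz]
    nlinarith [mul_le_mul_of_nonneg_left hG1 (mul_nonneg hV0.le hlogz.le)]
  · push Not at h
    have hlog : Real.log z ≤ 14 := by
      have := Real.log_lt_log (by linarith) h
      rw [Real.log_exp] at this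
      exact this.le
    rw [le_div_iff₀ hlogz]
    nlinarith


/-! ### The Euler product `∏_{p<z}(1 − p^{-2}) = (6/π²)(1 + O(1/z))` -/

/-- The partial products `∏_{p<n}(1 − p^{-2})` over the naturals. [folklore] -/
def invSqProdNat (n : ℕ) : ℝ := ∏ p ∈ Nat.primesBelow n, (1 - ((p : ℝ) ^ 2)⁻¹)

/-- `invSqProd z = invSqProdNat ⌈z⌉`. [folklore] -/
theorem invSqProd_eq (z : ℝ) : invSqProd z = invSqProdNat ⌈z⌉₊ := rfl

/-- **`∏_{p<n}(1 − p^{-2}) → 6/π²`** (Mathlib's Euler product for the completely multiplicative `n ↦ n^{-2}`,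
`EulerProduct.eulerProduct_completely_multiplicative`, and `∑ n^{-2} = π²/6`). [folklore] -/
theorem tendsto_invSqProdNat : Tendsto invSqProdNat atTop (𝓝 (6 / Real.pi ^ 2)) := by
  let F : ℕ →*₀ ℝ :=
    { toFun := fun n => ((n : ℝ) ^ 2)⁻¹
      map_zero' := by simp
      map_one' := by simp
      map_mul' := fun m n => by push_cast; rw [mul_pow, mul_inv] }
  have hF : ∀ n : ℕ, F n = ((n : ℝ) ^ 2)⁻¹ := fun n => rfl
  have hsum : Summable (fun n : ℕ => ‖F n‖) := by
    simp only [hF, norm_inv, norm_pow, Real.norm_natCast]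
    exact Real.summable_nat_pow_inv.mpr (by norm_num)
  have h := EulerProduct.eulerProduct_completely_multiplicative hsum
  have htsum : ∑' n : ℕ, F n = Real.pi ^ 2 / 6 := by
    rw [← hasSum_zeta_two.tsum_eq]
    exact tsum_congr fun n => by rw [hF, one_div]
  rw [htsum] at h
  have hne : Real.pi ^ 2 / 6 ≠ 0 := by positivity
  have h' := Tendsto.inv₀ h hne
  rw [inv_div] at h'
  refine h'.congr fun n => ?_
  rw [invSqProdNat, ← prod_inv_distrib]
  exact prod_congr rfl fun p _ => by rw [inv_inv, hF]

/-- `0 < ∏_{p<n}(1 − p^{-2})`, and the factors lie in `[3/4, 1]`. [folklore] -/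
theorem invSqProdNat_pos (n : ℕ) : 0 < invSqProdNat n := by
  refine prod_pos fun p hp => ?_
  have hp2 : (2 : ℝ) ≤ p := by exact_mod_cast (Nat.prime_of_mem_primesBelow hp).two_le
  have h1 : ((p : ℝ) ^ 2)⁻¹ ≤ 1 / 4 := by
    rw [inv_eq_one_div]; exact one_div_le_one_div_of_le (by norm_num) (by nlinarith)
  linarith

/-- Weierstrass' inequality `1 − ∑ εᵢ ≤ ∏ (1 − εᵢ)` for `0 ≤ εᵢ ≤ 1` (a private copy of
`Literature.NumberTheory.Sieve.CFZ.one_sub_sum_le_prod_one_sub`, to keep the import closure small).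
[folklore] -/
private theorem prod_one_sub_ge {ι : Type*} (s : Finset ι) (ε : ι → ℝ) (h : ∀ i ∈ s, 0 ≤ ε i ∧ ε i ≤ 1) :
    1 - ∑ i ∈ s, ε i ≤ ∏ i ∈ s, (1 - ε i) := by
  classical
  induction s using Finset.induction_on with
  | empty => simp
  | insert a s ha ih =>
    have h' : ∀ i ∈ s, 0 ≤ ε i ∧ ε i ≤ 1 := fun i hi => h i (mem_insert_of_mem hi)
    rw [sum_insert ha, prod_insert ha]
    have hP1 : ∏ i ∈ s, (1 - ε i) ≤ 1 := prod_le_one (fun i hi => by linarith [(h' i hi).2]) fun i hi => by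
      linarith [(h' i hi).1]
    have ha0 := (h a (mem_insert_self a s)).1
    nlinarith [ih h', mul_le_mul_of_nonneg_left hP1 ha0]

/-- Monotonicity with the tail: for `3 ≤ n ≤ m`,
`invSqProdNat n (1 − 2/(n−1)) ≤ invSqProdNat m ≤ invSqProdNat n`. [folklore] -/
theorem invSqProdNat_bounds {n m : ℕ} (hn : 3 ≤ n) (hnm : n ≤ m) :
    invSqProdNat n * (1 - 2 / ((n : ℝ) - 1)) ≤ invSqProdNat m ∧ invSqProdNat m ≤ invSqProdNat n := by
  have hsub : Nat.primesBelow n ⊆ Nat.primesBelow m := fun p hp => by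
    rw [Nat.mem_primesBelow] at hp ⊢; exact ⟨lt_of_lt_of_le hp.1 hnm, hp.2⟩
  have hsplit : invSqProdNat m = (∏ p ∈ Nat.primesBelow m \ Nat.primesBelow n, (1 - ((p : ℝ) ^ 2)⁻¹)) *
      invSqProdNat n := by
    rw [invSqProdNat, invSqProdNat, prod_sdiff hsub]
  have hf01 : ∀ p ∈ Nat.primesBelow m \ Nat.primesBelow n, 0 ≤ ((p : ℝ) ^ 2)⁻¹ ∧ ((p : ℝ) ^ 2)⁻¹ ≤ 1 := by
    intro p hp
    have hp2 : (2 : ℝ) ≤ p := by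
      exact_mod_cast (Nat.prime_of_mem_primesBelow (Finset.mem_sdiff.mp hp).1).two_le
    exact ⟨by positivity, inv_le_one_of_one_le₀ (by nlinarith)⟩
  have htail1 : ∏ p ∈ Nat.primesBelow m \ Nat.primesBelow n, (1 - ((p : ℝ) ^ 2)⁻¹) ≤ 1 :=
    prod_le_one (fun p hp => by linarith [(hf01 p hp).2]) fun p hp => by linarith [(hf01 p hp).1]
  have htail2 : 1 - 2 / ((n : ℝ) - 1) ≤ ∏ p ∈ Nat.primesBelow m \ Nat.primesBelow n, (1 - ((p : ℝ) ^ 2)⁻¹) := by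
    have hW := prod_one_sub_ge (Nat.primesBelow m \ Nat.primesBelow n) (fun p => ((p : ℝ) ^ 2)⁻¹) hf01
    have hn1 : (2 : ℝ) ≤ (n : ℝ) - 1 := by
      have : (3 : ℝ) ≤ n := by exact_mod_cast hn
      linarith
    have hsum : ∑ p ∈ Nat.primesBelow m \ Nat.primesBelow n, ((p : ℝ) ^ 2)⁻¹ ≤ 2 / ((n : ℝ) - 1) := by
      refine sum_inv_sq_tail_le hn1 _ fun p hp => ?_
      rw [Finset.mem_sdiff, Nat.mem_primesBelow, Nat.mem_primesBelow, not_and_or, not_lt] at hp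
      rcases hp.2 with h | h
      · have : (n : ℝ) ≤ p := by exact_mod_cast h
        linarith
      · exact absurd hp.1.2 h
    linarith
  have hI0 := invSqProdNat_pos n
  rw [hsplit]
  constructor
  · calc invSqProdNat n * (1 - 2 / ((n : ℝ) - 1))
        ≤ invSqProdNat n * ∏ p ∈ Nat.primesBelow m \ Nat.primesBelow n, (1 - ((p : ℝ) ^ 2)⁻¹) :=
          mul_le_mul_of_nonneg_left htail2 hI0.le
      _ = _ := mul_comm _ _
  · exact mul_le_of_le_one_left hI0.le htail1

/-- **`6/π² ≤ ∏_{p<z}(1 − p^{-2})` and `∏_{p<z}(1 − p^{-2})·(1 − 2/(z−1)) ≤ 6/π²`** for `z ≥ 3`: the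
limit `6/π²` of the decreasing partial products lies between `invSqProd z (1 − 2/(⌈z⌉−1))` and
`invSqProd z`. [folklore] -/
theorem invSqProd_bounds {z : ℝ} (hz : 3 ≤ z) :
    6 / Real.pi ^ 2 ≤ invSqProd z ∧ invSqProd z * (1 - 2 / (z - 1)) ≤ 6 / Real.pi ^ 2 := by
  rw [invSqProd_eq]
  set n : ℕ := ⌈z⌉₊ with hn
  have hn3 : 3 ≤ n := Nat.le_of_lt_succ (by
    have : (3 : ℝ) ≤ ⌈z⌉₊ := hz.trans (Nat.le_ceil z)
    exact_mod_cast (show (3 : ℕ) < ⌈z⌉₊ + 1 by exact_mod_cast (by linarith : (3 : ℝ) < ⌈z⌉₊ + 1)))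
  have hnz : z ≤ n := Nat.le_ceil z
  have hev : ∀ᶠ m : ℕ in atTop, invSqProdNat n * (1 - 2 / ((n : ℝ) - 1)) ≤ invSqProdNat m ∧
      invSqProdNat m ≤ invSqProdNat n :=
    (eventually_ge_atTop n).mono fun m hm => invSqProdNat_bounds hn3 hm
  have h1 : 6 / Real.pi ^ 2 ≤ invSqProdNat n := le_of_tendsto tendsto_invSqProdNat (hev.mono fun m h => h.2)
  have h2 : invSqProdNat n * (1 - 2 / ((n : ℝ) - 1)) ≤ 6 / Real.pi ^ 2 :=
    ge_of_tendsto tendsto_invSqProdNat (hev.mono fun m h => h.1)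
  refine ⟨h1, le_trans ?_ h2⟩
  refine mul_le_mul_of_nonneg_left ?_ (invSqProdNat_pos n).le
  have : 2 / ((n : ℝ) - 1) ≤ 2 / (z - 1) := div_le_div_of_nonneg_left (by norm_num) (by linarith) (by linarith)
  linarith


/-! ### The singular product: `∏_{p<N}(1 − (ν_p−1)/p) = σ₀(1 + O(1/log N))` -/

/-- `primesBelow M = primesLE ⌊M − 1⌋` for `M ≥ 1` (as finite sets of naturals). [folklore] -/
theorem primesBelow_eq_primesLE {M : ℕ} (hM : 1 ≤ M) :
    Nat.primesBelow M = Nat.primesLE ⌊(((M - 1 : ℕ)) : ℝ)⌋₊ := by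
  rw [Nat.floor_natCast, Nat.primesLE, Nat.sub_add_cancel hM]

/-- The factor `1 − (ν_p − 1)/p` of the singular product is within `2/p` of `1`, positive for `p ≥ 3`,
and `ν_p = c_K(p)`. [folklore] -/
theorem singularFactor_bounds {p : ℕ} (hp : p.Prime) :
    |((cubeRootTwoCount p : ℝ) - 1) / p| ≤ 2 / p ∧ (idealNormCount K p : ℝ) = cubeRootTwoCount p := by
  have hp0 : (0 : ℝ) < p := by exact_mod_cast hp.pos
  have hν : (cubeRootTwoCount p : ℝ) ≤ 3 := by exact_mod_cast cubeRootTwoCount_le_three hp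
  have hν0 : (0 : ℝ) ≤ cubeRootTwoCount p := Nat.cast_nonneg _
  refine ⟨?_, by exact_mod_cast card_absNorm_eq_prime_eq_cubeRootTwoCount hp⟩
  rw [abs_div, abs_of_pos hp0, div_le_div_iff_of_pos_right hp0, abs_le]
  constructor <;> linarith

/-- **The logarithm of a block of the singular product is small**: there is `C_S ≥ 0` with
`|log(S(M)/S(N))| ≤ C_S/log N` for all `4 ≤ N ≤ M`, `S(N) = ∏_{p<N}(1 − (ν_p−1)/p)`: by
`|log(1−t) + t| ≤ 2t²`, `∑_{p≥N} 8/p² ≤ 16/(N−1)`, and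
`|∑_{N ≤ p < M} (ν_p − 1)/p| ≤ 2(C_K + 8)/log(N−1)` from the two Mertens theorems with rate
(`∑_{p≤x} c_K(p)/p = log log x + c + O(1/log x)`, tree `sum_primesLE_idealNormCount_div_eq`, and
`∑_{p≤x} 1/p = log log x + B₁ + O(1/log x)`, tree `Mertens.abs_primeRecipSum_sub_le`). This is the
convergence "the infinite product `∏_{p>Y}(1 − (ν_p−1)/p)` … is `1 + O((log Y)^{-1})`" of p. 37.
[cite: HeathBrownActa2001, §6 (6.7)] -/
theorem exists_abs_log_singularProductPartial_div_le :
    ∃ C : ℝ, 0 ≤ C ∧ ∀ N M : ℕ, 4 ≤ N → N ≤ M →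
      |Real.log (singularProductPartial M / singularProductPartial N)| ≤ C / Real.log N := by
  classical
  obtain ⟨c, C_K, hF⟩ := Literature.NumberTheory.LFunctions.NumberField.sum_primesLE_idealNormCount_div_eq K 0
  have hCK0 : 0 ≤ C_K := by
    have h := hF 2 le_rfl
    rw [zero_add, pow_one] at h
    by_contra hneg
    have : C_K / Real.log 2 < 0 := div_neg_of_neg_of_pos (not_le.mp hneg) (Real.log_pos one_lt_two)
    linarith [abs_nonneg (∑ p ∈ Nat.primesLE ⌊(2 : ℝ)⌋₊, (idealNormCount K p : ℝ) / p - (Real.log (Real.log 2) + c))]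
  refine ⟨32 + 4 * (C_K + 8), by positivity, fun N M hN hNM => ?_⟩
  have hCK8 : 0 ≤ C_K + 8 := by linarith
  set t : ℕ → ℝ := fun p => ((cubeRootTwoCount p : ℝ) - 1) / p with ht
  have hN1 : 1 ≤ N := by omega
  have hM1 : 1 ≤ M := by omega
  have hNr : (4 : ℝ) ≤ N := by exact_mod_cast hN
  have hlogN : 0 < Real.log N := Real.log_pos (by linarith)
  set B := Nat.primesBelow M \ Nat.primesBelow N with hB
  have hsub : Nat.primesBelow N ⊆ Nat.primesBelow M := fun p hp => by
    rw [Nat.mem_primesBelow] at hp ⊢; exact ⟨lt_of_lt_of_le hp.1 hNM, hp.2⟩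
  have hmemB : ∀ p ∈ B, p.Prime ∧ N ≤ p := fun p hp => by
    rw [hB, Finset.mem_sdiff, Nat.mem_primesBelow, Nat.mem_primesBelow, not_and_or, not_lt] at hp
    exact ⟨hp.1.2, hp.2.resolve_right (fun h => h hp.1.2)⟩
  -- `S(M)/S(N) = ∏_B (1 − t_p)`
  have hSpos := singularProductPartial_pos N
  have hquot : singularProductPartial M / singularProductPartial N = ∏ p ∈ B, (1 - t p) := by
    rw [div_eq_iff hSpos.ne', singularProductPartial_def, singularProductPartial_def, ← prod_sdiff hsub]
  -- the factors
  have hfac : ∀ p ∈ B, |t p| ≤ 2 / p ∧ |t p| ≤ 1 / 2 ∧ 0 < 1 - t p := by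
    intro p hp
    obtain ⟨hpp, hNp⟩ := hmemB p hp
    have hp4 : (4 : ℝ) ≤ p := by exact_mod_cast hN.trans hNp
    have h1 := (singularFactor_bounds hpp).1
    have h2 : (2 : ℝ) / p ≤ 1 / 2 := by rw [div_le_div_iff₀ (by linarith) two_pos]; linarith
    refine ⟨h1, h1.trans h2, ?_⟩
    have := (abs_le.mp (h1.trans h2)).2
    linarith
  -- `|log(1 − t) + t| ≤ 2t² ≤ 8/p²`
  have hlogfac : ∀ p ∈ B, |Real.log (1 - t p) + t p| ≤ 8 * ((p : ℝ) ^ 2)⁻¹ := by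
    intro p hp
    obtain ⟨h1, h2, -⟩ := hfac p hp
    obtain ⟨hpp, -⟩ := hmemB p hp
    have hp0 : (0 : ℝ) < p := by exact_mod_cast hpp.pos
    have h := Real.abs_log_sub_add_sum_range_le (show |t p| < 1 by linarith) 1
    simp only [sum_range_one, zero_add, pow_one, Nat.cast_zero, div_one] at h
    rw [add_comm] at h
    calc |Real.log (1 - t p) + t p| ≤ |t p| ^ (1 + 1) / (1 - |t p|) := h
      _ ≤ |t p| ^ 2 / (1 / 2) := by
          rw [show (1 : ℕ) + 1 = 2 from rfl]
          exact div_le_div_of_nonneg_left (sq_nonneg _) (by norm_num) (by linarith)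
      _ = 2 * |t p| ^ 2 := by ring
      _ ≤ 2 * (2 / p) ^ 2 := by gcongr
      _ = 8 * ((p : ℝ) ^ 2)⁻¹ := by field_simp; ring
  have hsum1 : ∑ p ∈ B, |Real.log (1 - t p) + t p| ≤ 16 / ((N : ℝ) - 1) := by
    calc ∑ p ∈ B, |Real.log (1 - t p) + t p| ≤ ∑ p ∈ B, 8 * ((p : ℝ) ^ 2)⁻¹ := sum_le_sum hlogfac
      _ = 8 * ∑ p ∈ B, ((p : ℝ) ^ 2)⁻¹ := by rw [mul_sum]
      _ ≤ 8 * (2 / ((N : ℝ) - 1)) := by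
          refine mul_le_mul_of_nonneg_left (sum_inv_sq_tail_le (by linarith) _ fun p hp => ?_) (by norm_num)
          have := (hmemB p hp).2
          have : (N : ℝ) ≤ p := by exact_mod_cast this
          linarith
      _ = 16 / ((N : ℝ) - 1) := by ring
  -- `∑_B t_p` through the two Mertens theorems
  have hsum2 : |∑ p ∈ B, t p| ≤ 2 * (C_K + 8) / Real.log ((N : ℝ) - 1) := by
    -- `∑_{p ∈ primesBelow L} t_p = F(L−1) − G(L−1)` with `|F(x) − G(x) − (c − B₁)| ≤ (C_K + 8)/log x`
    have hblock : ∀ L : ℕ, 4 ≤ L →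
        |∑ p ∈ Nat.primesBelow L, t p - (c - Literature.NumberTheory.LFunctions.Mertens.meisselMertens)| ≤
          (C_K + 8) / Real.log ((L : ℝ) - 1) := by
      intro L hL
      have hL1 : 1 ≤ L := by omega
      set x : ℝ := ((L - 1 : ℕ) : ℝ) with hx
      have hxL : x = (L : ℝ) - 1 := by rw [hx, Nat.cast_sub hL1, Nat.cast_one]
      have hL4 : (4 : ℝ) ≤ L := by exact_mod_cast hL
      have hx2 : 2 ≤ x := by rw [hxL]; linarith
      have hlogx : 0 < Real.log x := Real.log_pos (by linarith)
      have hFx := hF x hx2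
      have hGx := Literature.NumberTheory.LFunctions.Mertens.abs_primeRecipSum_sub_le hx2
      rw [zero_add, pow_one] at hFx
      rw [Literature.NumberTheory.LFunctions.Mertens.primeRecipSum] at hGx
      have hsumt : ∑ p ∈ Nat.primesBelow L, t p =
          ∑ p ∈ Nat.primesLE ⌊x⌋₊, (idealNormCount K p : ℝ) / p - ∑ p ∈ Nat.primesLE ⌊x⌋₊, (p : ℝ)⁻¹ := by
        rw [primesBelow_eq_primesLE hL1, ← hx, ← sum_sub_distrib]
        refine sum_congr rfl fun p hp => ?_
        have hpp : p.Prime := (Nat.mem_primesLE.mp hp).2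
        simp only [ht]
        rw [(singularFactor_bounds hpp).2, sub_div, div_eq_mul_inv (1 : ℝ), one_mul]
      rw [hsumt, ← hxL]
      have e1 := abs_le.mp hFx
      have e2 := abs_le.mp hGx
      rw [abs_le, add_div]
      constructor <;> linarith [e1.1, e1.2, e2.1, e2.2]
    have hM4 : 4 ≤ M := hN.trans hNM
    have hbN := hblock N hN
    have hbM := hblock M hM4
    have hsplit : ∑ p ∈ B, t p = ∑ p ∈ Nat.primesBelow M, t p - ∑ p ∈ Nat.primesBelow N, t p := by
      rw [hB, sum_sdiff_eq_sub hsub]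
    rw [hsplit]
    have hNM' : (N : ℝ) ≤ M := by exact_mod_cast hNM
    have hlogmono : Real.log ((N : ℝ) - 1) ≤ Real.log ((M : ℝ) - 1) :=
      Real.log_le_log (by linarith) (by linarith)
    have hlogN1 : 0 < Real.log ((N : ℝ) - 1) := Real.log_pos (by linarith)
    have hdivmono : (C_K + 8) / Real.log ((M : ℝ) - 1) ≤ (C_K + 8) / Real.log ((N : ℝ) - 1) :=
      div_le_div_of_nonneg_left hCK8 hlogN1 hlogmono
    have h2 : 2 * (C_K + 8) / Real.log ((N : ℝ) - 1) = 2 * ((C_K + 8) / Real.log ((N : ℝ) - 1)) := by ring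
    have eN := abs_le.mp hbN
    have eM := abs_le.mp hbM
    rw [abs_le, h2]
    constructor <;> linarith [eN.1, eN.2, eM.1, eM.2]
  -- combine
  have hlogprod : Real.log (∏ p ∈ B, (1 - t p)) = ∑ p ∈ B, Real.log (1 - t p) :=
    Real.log_prod fun p hp => (hfac p hp).2.2.ne'
  have hN1r : Real.log N / 2 ≤ Real.log ((N : ℝ) - 1) := by
    have hsq : Real.sqrt N ≤ (N : ℝ) - 1 := by
      rw [Real.sqrt_le_left (by linarith)]
      nlinarith
    calc Real.log N / 2 = Real.log (Real.sqrt N) := by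
          rw [Real.log_sqrt (by linarith)]
      _ ≤ Real.log ((N : ℝ) - 1) := Real.log_le_log (Real.sqrt_pos.mpr (by linarith)) hsq
  have hlogN1 : 0 < Real.log ((N : ℝ) - 1) := Real.log_pos (by linarith)
  have hNlog : Real.log N ≤ (N : ℝ) - 1 := by
    have := Real.log_le_sub_one_of_pos (show (0 : ℝ) < N by linarith)
    linarith
  rw [hquot, hlogprod]
  calc |∑ p ∈ B, Real.log (1 - t p)| = |∑ p ∈ B, (Real.log (1 - t p) + t p) - ∑ p ∈ B, t p| := by
        rw [sum_add_distrib]; ring_nf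
    _ ≤ |∑ p ∈ B, (Real.log (1 - t p) + t p)| + |∑ p ∈ B, t p| := abs_sub _ _
    _ ≤ ∑ p ∈ B, |Real.log (1 - t p) + t p| + |∑ p ∈ B, t p| := by
        gcongr; exact abs_sum_le_sum_abs _ _
    _ ≤ 16 / ((N : ℝ) - 1) + 2 * (C_K + 8) / Real.log ((N : ℝ) - 1) := add_le_add hsum1 hsum2
    _ ≤ 32 / Real.log N + 4 * (C_K + 8) / Real.log N := by
        have hA : 16 / ((N : ℝ) - 1) ≤ 32 / Real.log N := by
          rw [div_le_div_iff₀ (by linarith) hlogN]; nlinarith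
        have hB' : 2 * (C_K + 8) / Real.log ((N : ℝ) - 1) ≤ 4 * (C_K + 8) / Real.log N := by
          rw [div_le_div_iff₀ hlogN1 hlogN]
          nlinarith [mul_le_mul_of_nonneg_left hN1r hCK8]
        exact add_le_add hA hB'
    _ = (32 + 4 * (C_K + 8)) / Real.log N := by ring

/-- **`σ₀ > 0` and `|S(N) − σ₀| ≤ 2C_Sσ₀/log N`** for `N ≥ 4` with `log N ≥ C_S`, where
`S(N) = ∏_{p<N}(1 − (ν_p−1)/p) → σ₀`: the rate in "`∏_{p<z}(1 − (ν_p−1)/p) = σ₀(1 + O((log z)^{-2}))`" of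
(6.7) (we prove `O((log z)^{-1})`, which suffices). Positivity of `σ₀` — i.e. convergence of the product
in the classical sense — is a by-product of the uniform bound on the blocks. [cite: HeathBrownActa2001, §6 (6.7)] -/
theorem exists_abs_singularProductPartial_sub_le {σ₀ : ℝ}
    (hσ : Tendsto singularProductPartial atTop (𝓝 σ₀)) :
    0 < σ₀ ∧ ∃ C : ℝ, 0 ≤ C ∧ ∀ N : ℕ, 4 ≤ N → C ≤ Real.log N →
      |singularProductPartial N - σ₀| ≤ 2 * C * σ₀ / Real.log N := by
  obtain ⟨C, hC0, hblock⟩ := exists_abs_log_singularProductPartial_div_le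
  -- uniform two-sided control of `log S(M)` for `M ≥ N`
  have hunif : ∀ N : ℕ, 4 ≤ N → ∀ᶠ M : ℕ in atTop,
      |Real.log (singularProductPartial M) - Real.log (singularProductPartial N)| ≤ C / Real.log N := by
    intro N hN
    refine (eventually_ge_atTop N).mono fun M hM => ?_
    have h := hblock N M hN hM
    rwa [Real.log_div (singularProductPartial_pos M).ne' (singularProductPartial_pos N).ne'] at h
  -- positivity of `σ₀`
  have hpos : 0 < σ₀ := by
    have h4 := hunif 4 le_rfl
    set m : ℝ := singularProductPartial 4 * Real.exp (-(C / Real.log 4)) with hm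
    have hm0 : 0 < m := mul_pos (singularProductPartial_pos 4) (Real.exp_pos _)
    have hev : ∀ᶠ M : ℕ in atTop, m ≤ singularProductPartial M := by
      refine h4.mono fun M hM => ?_
      have hSM := singularProductPartial_pos M
      have hS4 := singularProductPartial_pos 4
      have hlow : Real.log (singularProductPartial 4) - C / Real.log 4 ≤ Real.log (singularProductPartial M) := by
        linarith [(abs_le.mp hM).1]
      calc m = Real.exp (Real.log (singularProductPartial 4) - C / Real.log 4) := by
            rw [hm, Real.exp_sub, Real.exp_log hS4, Real.exp_neg]; ring
        _ ≤ Real.exp (Real.log (singularProductPartial M)) := Real.exp_le_exp.mpr hlow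
        _ = singularProductPartial M := Real.exp_log hSM
    exact lt_of_lt_of_le hm0 (ge_of_tendsto hσ hev)
  refine ⟨hpos, C, hC0, fun N hN hCN => ?_⟩
  have hNr : (4 : ℝ) ≤ N := by exact_mod_cast hN
  have hlogN : 0 < Real.log N := Real.log_pos (by linarith)
  set δ : ℝ := C / Real.log N with hδ
  have hδ0 : 0 ≤ δ := div_nonneg hC0 hlogN.le
  have hδ1 : δ ≤ 1 := by rw [hδ, div_le_one hlogN]; exact hCN
  -- `|log σ₀ − log S(N)| ≤ δ`
  have hlogσ : Tendsto (fun M => Real.log (singularProductPartial M)) atTop (𝓝 (Real.log σ₀)) :=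
    (Real.continuousAt_log hpos.ne').tendsto.comp hσ
  have hI : |Real.log σ₀ - Real.log (singularProductPartial N)| ≤ δ := by
    have hev := hunif N hN
    rw [abs_le]
    constructor
    · have := ge_of_tendsto hlogσ (hev.mono fun M hM => by
        show Real.log (singularProductPartial N) - δ ≤ Real.log (singularProductPartial M)
        linarith [(abs_le.mp hM).1])
      linarith
    · have := le_of_tendsto hlogσ (hev.mono fun M hM => by
        show Real.log (singularProductPartial M) ≤ Real.log (singularProductPartial N) + δ
        linarith [(abs_le.mp hM).2])
      linarith
  -- back to `S(N) − σ₀`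
  set u : ℝ := Real.log (singularProductPartial N) - Real.log σ₀ with hu
  have hu1 : |u| ≤ δ := by rw [hu, abs_sub_comm]; exact hI
  have hSN : singularProductPartial N = σ₀ * Real.exp u := by
    rw [hu, Real.exp_sub, Real.exp_log (singularProductPartial_pos N), Real.exp_log hpos]
    field_simp
  have hexp : |Real.exp u - 1| ≤ 2 * δ := by
    have h := Real.abs_exp_sub_one_sub_id_le (hu1.trans hδ1)
    have : |Real.exp u - 1| ≤ |Real.exp u - 1 - u| + |u| := by
      have := abs_add_le (Real.exp u - 1 - u) u
      simpa using this
    have hu2 : u ^ 2 ≤ δ := by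
      calc u ^ 2 = |u| ^ 2 := (sq_abs u).symm
        _ ≤ δ ^ 2 := pow_le_pow_left₀ (abs_nonneg u) hu1 2
        _ ≤ δ := by nlinarith
    linarith
  calc |singularProductPartial N - σ₀| = σ₀ * |Real.exp u - 1| := by
        rw [hSN, show σ₀ * Real.exp u - σ₀ = σ₀ * (Real.exp u - 1) by ring, abs_mul, abs_of_pos hpos]
    _ ≤ σ₀ * (2 * δ) := mul_le_mul_of_nonneg_left hexp hpos.le
    _ = 2 * C * σ₀ / Real.log N := by rw [hδ]; ring


/-! ### (6.7): `(6/π²) ∏_{p<z}(1 − ρ₀(p)/p) = σ₀ (1 + O(1/log z)) ∏_{p<z}(1 − 1/p)` -/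

/-- The factorisation `1 − ρ₀(p)/p = (1 − (ν_p−1)/p)(1 − 1/p)(1 − p^{-2})^{-1}` at a prime `p`
((6.7), first line: "`∏_{p<z}(1 − ρ₀(p)/p) = ∏_{p<z}(1 − (ν_p−1)/p)(1 − 1/p)(1 − 1/p²)^{-1}`").
[cite: HeathBrownActa2001, §6 (6.7)] -/
theorem one_sub_densA_eq {p : ℕ} (hp : p.Prime) :
    1 - densA p = (1 - ((cubeRootTwoCount p : ℝ) - 1) / p) * (1 - (p : ℝ)⁻¹) * (1 - ((p : ℝ) ^ 2)⁻¹)⁻¹ := by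
  rw [densA_prime hp]
  have hp2 : (2 : ℝ) ≤ p := by exact_mod_cast hp.two_le
  have hp0 : (p : ℝ) ≠ 0 := by positivity
  have hp1 : (p : ℝ) + 1 ≠ 0 := by positivity
  have hpm : (p : ℝ) - 1 ≠ 0 := by linarith
  have hsq : 1 - ((p : ℝ) ^ 2)⁻¹ = ((p : ℝ) - 1) * ((p : ℝ) + 1) / (p : ℝ) ^ 2 := by field_simp; ring
  rw [hsq]
  field_simp
  ring

/-- **`V_𝒜(z) = S(⌈z⌉) · V(z) / ∏_{p<z}(1 − p^{-2})`**, `S(N) = ∏_{p<N}(1 − (ν_p−1)/p)` the partial singular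
product (`singularProductPartial`). [cite: HeathBrownActa2001, §6 (6.7)] -/
theorem prodA_eq (z : ℝ) : prodA z = singularProductPartial ⌈z⌉₊ * mertensProd z * (invSqProd z)⁻¹ := by
  rw [prodA, singularProductPartial_def, mertensProd, invSqProd, ← prod_mul_distrib, ← prod_inv_distrib,
    ← prod_mul_distrib]
  exact prod_congr rfl fun p hp => one_sub_densA_eq (Nat.prime_of_mem_primesBelow hp)

/-- **(6.7)**: `|(6/π²)V_𝒜(z) − σ₀V(z)| ≤ C V(z)/log z` for `z ≥ z₀`, where `σ₀ = lim S(N)` (assumed to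
exist; then `σ₀ > 0`), `V(z) = ∏_{p<z}(1 − 1/p)`: "`∏_{p<z}(1 − ρ₀(p)/p) = (π²/6)σ₀(1 + O((log z)^{-2}))∏_{p<z}(1 − 1/p)`"
(we prove the rate `O(1/log z)`, which suffices for Lemma 3.5). [cite: HeathBrownActa2001, §6 (6.7)] -/
theorem exists_abs_prodA_sub_le {σ₀ : ℝ} (hσ : Tendsto singularProductPartial atTop (𝓝 σ₀)) :
    0 < σ₀ ∧ ∃ C z₀ : ℝ, 0 ≤ C ∧ ∀ z : ℝ, z₀ ≤ z →
      |6 / Real.pi ^ 2 * prodA z - σ₀ * mertensProd z| ≤ C * mertensProd z / Real.log z := by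
  obtain ⟨hpos, C, hC0, hrate⟩ := exists_abs_singularProductPartial_sub_le hσ
  refine ⟨hpos, 2 * σ₀ * (C + 1), max 4 (Real.exp C), by positivity, fun z hz => ?_⟩
  have hz4 : 4 ≤ z := le_trans (le_max_left _ _) hz
  have hzC : Real.exp C ≤ z := le_trans (le_max_right _ _) hz
  have hz0 : 0 < z := by linarith
  have hlogz : 0 < Real.log z := Real.log_pos (by linarith)
  set N : ℕ := ⌈z⌉₊ with hN
  have hNz : z ≤ N := Nat.le_ceil z
  have hN4 : 4 ≤ N := by
    have : (4 : ℝ) ≤ N := hz4.trans hNz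
    exact_mod_cast this
  have hlogN : Real.log z ≤ Real.log N := Real.log_le_log hz0 hNz
  have hClog : C ≤ Real.log N := by
    have : C ≤ Real.log z := by rw [← Real.log_exp C]; exact Real.log_le_log (Real.exp_pos C) hzC
    linarith
  have hS := hrate N hN4 hClog
  obtain ⟨hE1, hE2⟩ := invSqProd_bounds (show (3 : ℝ) ≤ z by linarith)
  have hI0 : 0 < invSqProd z := invSqProdNat_pos _
  obtain ⟨hV0, -⟩ := mertensProd_pos_le z
  set E := invSqProd z with hE
  set S := singularProductPartial N with hSdef
  set V := mertensProd z with hV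
  set r : ℝ := 6 / Real.pi ^ 2 * E⁻¹ with hr
  have hr1 : r ≤ 1 := by rw [hr, ← div_eq_mul_inv, div_le_one hI0]; exact hE1
  have hr0 : 1 - 2 / (z - 1) ≤ r := by
    rw [hr, ← div_eq_mul_inv, le_div_iff₀ hI0]; linarith
  have hrnn : 0 ≤ r := by rw [hr]; positivity
  -- `(6/π²) V_𝒜 − σ₀ V = V (r S − σ₀)`
  have hkey : 6 / Real.pi ^ 2 * prodA z - σ₀ * V = V * (r * S - σ₀) := by
    rw [prodA_eq, ← hE, ← hSdef, ← hV, hr]; ring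
  have hrS : |r * S - σ₀| ≤ |S - σ₀| + σ₀ * (2 / (z - 1)) := by
    have hS0 : 0 < S := singularProductPartial_pos N
    calc |r * S - σ₀| = |r * (S - σ₀) + σ₀ * (r - 1)| := by ring_nf
      _ ≤ |r * (S - σ₀)| + |σ₀ * (r - 1)| := abs_add_le _ _
      _ ≤ |S - σ₀| + σ₀ * (2 / (z - 1)) := by
          refine add_le_add ?_ ?_
          · rw [abs_mul, abs_of_nonneg hrnn]
            exact mul_le_of_le_one_left (abs_nonneg _) hr1
          · rw [abs_mul, abs_of_pos hpos, abs_of_nonpos (by linarith)]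
            exact mul_le_mul_of_nonneg_left (by linarith) hpos.le
  have hz1 : Real.log z ≤ z - 1 := by linarith [Real.log_le_sub_one_of_pos hz0]
  have hterm2 : σ₀ * (2 / (z - 1)) ≤ 2 * σ₀ / Real.log z := by
    rw [mul_div_assoc', mul_comm σ₀ 2, div_le_div_iff₀ (by linarith) hlogz]
    nlinarith
  have hterm1 : |S - σ₀| ≤ 2 * C * σ₀ / Real.log z := by
    refine hS.trans ?_
    exact div_le_div_of_nonneg_left (by positivity) hlogz hlogN
  rw [hkey, abs_mul, abs_of_pos hV0]
  calc V * |r * S - σ₀| ≤ V * (2 * C * σ₀ / Real.log z + 2 * σ₀ / Real.log z) :=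
        mul_le_mul_of_nonneg_left (hrS.trans (add_le_add hterm1 hterm2)) hV0.le
    _ = 2 * σ₀ * (C + 1) * V / Real.log z := by ring

/-- `V_𝒜(z) ≤ C/log z` for `z ≥ z₀` (from (6.7) and Mertens: `(6/π²)V_𝒜 ≤ σ₀V + CV/log z ≤ (σ₀ + C)V`).
[cite: HeathBrownActa2001, §6 (6.9)–(6.10)] -/
theorem exists_prodA_le {σ₀ : ℝ} (hσ : Tendsto singularProductPartial atTop (𝓝 σ₀)) :
    ∃ C z₀ : ℝ, 0 ≤ C ∧ ∀ z : ℝ, z₀ ≤ z → prodA z ≤ C / Real.log z := by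
  obtain ⟨hpos, C, z₀, hC0, h⟩ := exists_abs_prodA_sub_le hσ
  refine ⟨Real.pi ^ 2 / 6 * (σ₀ + C) * 14, max z₀ (Real.exp 1), by positivity, fun z hz => ?_⟩
  have hz₀ : z₀ ≤ z := le_trans (le_max_left _ _) hz
  have hze : Real.exp 1 ≤ z := le_trans (le_max_right _ _) hz
  have hz2 : 2 ≤ z := by linarith [Real.add_one_le_exp (1 : ℝ)]
  have hlog1 : 1 ≤ Real.log z := by rw [← Real.log_exp 1]; exact Real.log_le_log (Real.exp_pos 1) hze
  have hlogz : 0 < Real.log z := by linarith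
  have hb := (abs_le.mp (h z hz₀)).2
  obtain ⟨hV0, hV1⟩ := mertensProd_pos_le z
  have hVle := mertensProd_le hz2
  have h1 : C * mertensProd z / Real.log z ≤ C * mertensProd z := by
    rw [div_le_iff₀ hlogz]; nlinarith [mul_nonneg hC0 hV0.le]
  have h2 : 6 / Real.pi ^ 2 * prodA z ≤ (σ₀ + C) * mertensProd z := by nlinarith
  have hpi : 0 < Real.pi ^ 2 / 6 := by positivity
  calc prodA z = Real.pi ^ 2 / 6 * (6 / Real.pi ^ 2 * prodA z) := by field_simp
    _ ≤ Real.pi ^ 2 / 6 * ((σ₀ + C) * mertensProd z) := mul_le_mul_of_nonneg_left h2 hpi.le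
    _ ≤ Real.pi ^ 2 / 6 * ((σ₀ + C) * (14 / Real.log z)) := by
        refine mul_le_mul_of_nonneg_left (mul_le_mul_of_nonneg_left hVle (by linarith)) hpi.le
    _ = Real.pi ^ 2 / 6 * (σ₀ + C) * 14 / Real.log z := by ring

/-! ### (6.9): `γ₀ ∏_{p<z}∏_{P∣p}(1 − N(P)^{-1}) = (1 + O(1/log z)) ∏_{p<z}(1 − 1/p)`, from Mertens' theorem for `K` -/

/-- **(6.9) from Mertens' theorem for the prime ideals of `K` with the residue constant.** If
`∏_{p<z}∏_{P∣p}(1 − N(P)^{-1}) · e^γ γ₀ log z = 1 + O(1/log z)` (Mertens' theorem for the number field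
`K`, Rosen 1999, Thm 2, in the form grouped by rational primes — here a HYPOTHESIS), then
`|γ₀V_ℬ(z) − V(z)| ≤ C V(z)/log z` for `z ≥ z₀`: "`∏_{p<z}(1 − ρ₁(p)/p) = γ₀^{-1}(1 + O((log z)^{-2}))∏_{p<z}(1 − 1/p)`"
((6.9); we use the rate `O(1/log z)`). [cite: HeathBrownActa2001, §6 (6.8)–(6.9)] -/
theorem exists_abs_prodB_sub_le_of
    (hmer : ∃ C z₀ : ℝ, ∀ z : ℝ, z₀ ≤ z →
      |(∏ p ∈ Nat.primesBelow ⌈z⌉₊, (1 - normDensityAt p)) *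
          (Real.exp Real.eulerMascheroniConstant * gamma₀ * Real.log z) - 1| ≤ C / Real.log z) :
    ∃ C z₀ : ℝ, 0 ≤ C ∧ ∀ z : ℝ, z₀ ≤ z →
      |gamma₀ * prodB z - mertensProd z| ≤ C * mertensProd z / Real.log z := by
  obtain ⟨C_M, z_M, hM⟩ := hmer
  set G := Real.exp Real.eulerMascheroniConstant with hG
  have hG0 : 0 < G := Real.exp_pos _
  refine ⟨2 * (max C_M 0 + 60), max z_M (Real.exp 120), by positivity, fun z hz => ?_⟩
  have hzM : z_M ≤ z := le_trans (le_max_left _ _) hz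
  have hz120 : Real.exp 120 ≤ z := le_trans (le_max_right _ _) hz
  have hz14 : Real.exp 14 ≤ z := le_trans (Real.exp_le_exp.mpr (by norm_num)) hz120
  have hz0 : 0 < z := lt_of_lt_of_le (Real.exp_pos _) hz120
  have hlog120 : 120 ≤ Real.log z := by
    rw [← Real.log_exp 120]; exact Real.log_le_log (Real.exp_pos _) hz120
  have hlogz : 0 < Real.log z := by linarith
  set L := G * Real.log z with hL
  have hL0 : 0 < L := mul_pos hG0 hlogz
  have h1 := hM z hzM
  have h2 := abs_mertensProd_mul_sub_one_le hz14
  change |prodB z * (G * gamma₀ * Real.log z) - 1| ≤ C_M / Real.log z at h1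
  set θ₁ := gamma₀ * prodB z * L - 1 with hθ₁
  set θ₂ := mertensProd z * L - 1 with hθ₂
  have hθ₁' : |θ₁| ≤ max C_M 0 / Real.log z := by
    have : prodB z * (G * gamma₀ * Real.log z) - 1 = θ₁ := by rw [hθ₁, hL]; ring
    rw [this] at h1
    exact h1.trans (div_le_div_of_nonneg_right (le_max_left _ _) hlogz.le)
  have hθ₂' : |θ₂| ≤ 60 / Real.log z := h2
  have hθ₂half : |θ₂| ≤ 1 / 2 := hθ₂'.trans (by rw [div_le_iff₀ hlogz]; linarith)
  -- `γ₀V_ℬ − V = (θ₁ − θ₂)/L` and `1/L ≤ 2V`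
  have hdiff : gamma₀ * prodB z - mertensProd z = (θ₁ - θ₂) / L := by
    rw [hθ₁, hθ₂]; field_simp; ring
  have hVL : mertensProd z = (1 + θ₂) / L := by rw [hθ₂]; field_simp; ring
  have hinvL : 1 / L ≤ 2 * mertensProd z := by
    rw [hVL, div_le_iff₀ hL0]
    have : 2 * ((1 + θ₂) / L) * L = 2 * (1 + θ₂) := by field_simp
    rw [this]
    linarith [(abs_le.mp hθ₂half).1]
  obtain ⟨hV0, -⟩ := mertensProd_pos_le z
  rw [hdiff, abs_div, abs_of_pos hL0]
  calc |θ₁ - θ₂| / L ≤ (|θ₁| + |θ₂|) / L := div_le_div_of_nonneg_right (abs_sub _ _) hL0.le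
    _ ≤ (max C_M 0 / Real.log z + 60 / Real.log z) / L := div_le_div_of_nonneg_right (add_le_add hθ₁' hθ₂') hL0.le
    _ = (max C_M 0 + 60) / Real.log z * (1 / L) := by ring
    _ ≤ (max C_M 0 + 60) / Real.log z * (2 * mertensProd z) :=
        mul_le_mul_of_nonneg_left hinvL (by positivity)
    _ = 2 * (max C_M 0 + 60) * mertensProd z / Real.log z := by ring

end Literature.NumberTheory.Sieve.CubicSieve

end
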